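import Summits.RiemannHypothesis.RiemannHypothesis.Theorems.WeilFormatCMixedArchExpansion
import HarnessLib

/-!
# Format C, design C∞: `J_s(m)`, `J_c(m)` as REAL polynomials in `1/ω_m` with collected coefficients

Route context: Fourier–Galerkin / Schur-complement certificates of Weil positivity on a window ("format C";
cell memo `run/shared/lean/pub/rh-explicit/rh-explicit-weil-10/KERNEL-LEVER.md` §20; supporting stmt-RiemannHypothesis-0098;
seat rh-explicit-weil-10).  `WeilFormatCMixedArchExpansion` expands the archimedean families `J_s(m) = ∫ρ sin(ω_m t)`,
`J_c(m) = ∫ρ(1 − cos ω_m t)` (`ω_m = πm/a ≥ 2`) to any order, the main part being written through the COMPLEX polynomial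
`E_{ν,K}` of `norm_digamma_quarter_sub_expansion_le`.  Here the real and imaginary parts are taken and the coefficients of each
power of `1/ω` are COLLECTED, so that a rung's kernel file reads the family coefficients off directly (rational numbers and the node
moments `D_s(a) = Σ_k e^{−2al_k} l_k^s`), with the same explicit remainder:

* `abs_setIntegral_sin_sub_realExpansion_le` —
  `J_s(m) = π/4 + Σ_{N=1}^{K} σ_N (1 − 1/(2N) − ½Σ_{k=1}^{ν} (B_{2k}/(2k)) 16^k C(N−1, 2k−1)) / (2^N ω^N) − Σ_{r<R} (−1)^r D_{2r}/ω^{2r+1} ± rem`,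
  `σ_N = Im i^N = (0, 1, 0, −1)` by `N mod 4`;
* `abs_setIntegral_one_sub_cos_sub_realExpansion_le` —
  `J_c(m) = ½log(ω/2) + Σ_{N=1}^{K} c_N (same bracket) / (2^N ω^N) − ½Re ψ(¼) − Σ_k e^{−2al_k}/l_k + Σ_{r<R} (−1)^r D_{2r+1}/ω^{2r+2} ± rem`,
  `c_N = Re i^N = (1, 0, −1, 0)` by `N mod 4`.

(Leading coefficients: `J_s − π/4 = (¼ − D_0)/ω + (1/16 + D_2)/ω³ + (5/64 − D_4)/ω⁵ + …`,
`J_c − ½log(ω/2) + ½ψ(¼) + Σe^{−2al}/l = (D_1 − 1/48)/ω² − (D_3 + 7/1920)/ω⁴ + …`.)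
Take `K ∈ {2ν, 2ν+1}`: for `N > 2ν + 1` the bracket lacks the Bernoulli corrections of order `> ν` (the statement stays true — the
first remainder term `~ω^{−2ν}` dominates there — but those coefficients are then not the asymptotic ones).
Tools: `im_quarterExpansion_eq` / `re_quarterExpansion_eq` (real and imaginary parts of `E_{ν,K}`) and the coefficient
collection `collect_quarterExpansion`.  Pure algebra over the two landed expansions; standard axioms; no definitions; no RH claim.
-/

set_option autoImplicit false
-- `Summit.RiemannHypothesis.RiemannHypothesis.…` is the layout-mandated namespace (summit = problem name).
set_option linter.dupNamespace false

noncomputable section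

open Complex Filter Set MeasureTheory
open scoped Real Topology

namespace Summit.RiemannHypothesis.RiemannHypothesis.Theorems.WeilFormatC

open Literature.NumberTheory.LFunctions Literature.Analysis.SpecialFunctions

variable {a : ℝ}

/-! ## Real and imaginary parts of the expansion polynomial `E_{ν,K}(L, t)` -/

/-- **`Im E_{ν,K}`** as a real expression in `t` (`L`, `t` real). -/
theorem im_quarterExpansion_eq (L t : ℝ) (ν K : ℕ) :
    (((L : ℝ) : ℂ) + ((π / 2 : ℝ) : ℂ) * I
        - ∑ n ∈ Finset.Icc 1 K, (I * (t : ℂ)) ^ n / (n : ℂ)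
        + 2 * ∑ n ∈ Finset.range K, (I * (t : ℂ)) ^ (n + 1)
        - ∑ k ∈ Finset.Icc 1 ν, (bernoulli (2 * k) : ℂ) / (2 * k) * 16 ^ k *
            ∑ n ∈ Finset.range (K - 2 * k + 1), ((n + (2 * k - 1)).choose (2 * k - 1) : ℂ) *
              (I * (t : ℂ)) ^ (n + 2 * k)).im
      = π / 2 - (∑ n ∈ Finset.Icc 1 K, (I ^ n).im * (t ^ n / n))
        + 2 * ∑ n ∈ Finset.range K, (I ^ (n + 1)).im * t ^ (n + 1)
        - ∑ k ∈ Finset.Icc 1 ν, ∑ n ∈ Finset.range (K - 2 * k + 1), (I ^ (n + 2 * k)).im *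
            ((bernoulli (2 * k) : ℝ) / (2 * k) * 16 ^ k *
              ((((n + (2 * k - 1)).choose (2 * k - 1) : ℕ) : ℝ) * t ^ (n + 2 * k))) := by
  have h1 : ∀ n : ℕ, (I * (t : ℂ)) ^ n / (n : ℂ) = I ^ n * (((t ^ n / n : ℝ)) : ℂ) := by
    intro n; rw [mul_pow]; push_cast; ring
  have h2 : ∀ n : ℕ, (I * (t : ℂ)) ^ (n + 1) = I ^ (n + 1) * (((t ^ (n + 1) : ℝ)) : ℂ) := by
    intro n; rw [mul_pow]; push_cast; ring
  have h3 : ∀ k : ℕ, (bernoulli (2 * k) : ℂ) / (2 * k) * 16 ^ k *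
      ∑ n ∈ Finset.range (K - 2 * k + 1), ((n + (2 * k - 1)).choose (2 * k - 1) : ℂ) * (I * (t : ℂ)) ^ (n + 2 * k)
      = ∑ n ∈ Finset.range (K - 2 * k + 1), I ^ (n + 2 * k) *
          (((bernoulli (2 * k) : ℝ) / (2 * k) * 16 ^ k *
            ((((n + (2 * k - 1)).choose (2 * k - 1) : ℕ) : ℝ) * t ^ (n + 2 * k)) : ℝ) : ℂ) := by
    intro k
    rw [Finset.mul_sum]
    refine Finset.sum_congr rfl fun n _ ↦ ?_
    rw [mul_pow]; push_cast; ring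
  simp_rw [h1, h2, h3]
  simp only [Complex.sub_im, Complex.add_im, Complex.im_sum, Complex.mul_im, Complex.ofReal_re, Complex.ofReal_im,
    Complex.I_re, Complex.I_im, mul_zero, add_zero, zero_add, mul_one]
  norm_num

/-- **`Re E_{ν,K}`** as a real expression in `t` (`L`, `t` real). -/
theorem re_quarterExpansion_eq (L t : ℝ) (ν K : ℕ) :
    (((L : ℝ) : ℂ) + ((π / 2 : ℝ) : ℂ) * I
        - ∑ n ∈ Finset.Icc 1 K, (I * (t : ℂ)) ^ n / (n : ℂ)
        + 2 * ∑ n ∈ Finset.range K, (I * (t : ℂ)) ^ (n + 1)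
        - ∑ k ∈ Finset.Icc 1 ν, (bernoulli (2 * k) : ℂ) / (2 * k) * 16 ^ k *
            ∑ n ∈ Finset.range (K - 2 * k + 1), ((n + (2 * k - 1)).choose (2 * k - 1) : ℂ) *
              (I * (t : ℂ)) ^ (n + 2 * k)).re
      = L - (∑ n ∈ Finset.Icc 1 K, (I ^ n).re * (t ^ n / n))
        + 2 * ∑ n ∈ Finset.range K, (I ^ (n + 1)).re * t ^ (n + 1)
        - ∑ k ∈ Finset.Icc 1 ν, ∑ n ∈ Finset.range (K - 2 * k + 1), (I ^ (n + 2 * k)).re *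
            ((bernoulli (2 * k) : ℝ) / (2 * k) * 16 ^ k *
              ((((n + (2 * k - 1)).choose (2 * k - 1) : ℕ) : ℝ) * t ^ (n + 2 * k))) := by
  have h1 : ∀ n : ℕ, (I * (t : ℂ)) ^ n / (n : ℂ) = I ^ n * (((t ^ n / n : ℝ)) : ℂ) := by
    intro n; rw [mul_pow]; push_cast; ring
  have h2 : ∀ n : ℕ, (I * (t : ℂ)) ^ (n + 1) = I ^ (n + 1) * (((t ^ (n + 1) : ℝ)) : ℂ) := by
    intro n; rw [mul_pow]; push_cast; ring
  have h3 : ∀ k : ℕ, (bernoulli (2 * k) : ℂ) / (2 * k) * 16 ^ k *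
      ∑ n ∈ Finset.range (K - 2 * k + 1), ((n + (2 * k - 1)).choose (2 * k - 1) : ℂ) * (I * (t : ℂ)) ^ (n + 2 * k)
      = ∑ n ∈ Finset.range (K - 2 * k + 1), I ^ (n + 2 * k) *
          (((bernoulli (2 * k) : ℝ) / (2 * k) * 16 ^ k *
            ((((n + (2 * k - 1)).choose (2 * k - 1) : ℕ) : ℝ) * t ^ (n + 2 * k)) : ℝ) : ℂ) := by
    intro k
    rw [Finset.mul_sum]
    refine Finset.sum_congr rfl fun n _ ↦ ?_
    rw [mul_pow]; push_cast; ring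
  simp_rw [h1, h2, h3]
  simp only [Complex.sub_re, Complex.add_re, Complex.re_sum, Complex.mul_re, Complex.ofReal_re, Complex.ofReal_im,
    Complex.I_re, Complex.I_im, mul_zero, sub_zero, add_zero, mul_one]
  norm_num

/-! ## Collecting the coefficient of each power -/

/-- **Coefficient collection** (`2ν ≤ K`): for any weights `s`, coefficients `b` and constant `c`,
`c − Σ_{n=1}^{K} s_n tⁿ/n + 2Σ_{n<K} s_{n+1} t^{n+1} − Σ_{k=1}^{ν} Σ_{n ≤ K−2k} s_{n+2k} b_k C(n+2k−1, 2k−1) t^{n+2k}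
 = c + Σ_{N=1}^{K} s_N (2 − 1/N − Σ_{k=1}^{ν} b_k C(N−1, 2k−1)) t^N` (the binomials vanish for `N < 2k`). -/
theorem collect_quarterExpansion (s b : ℕ → ℝ) (c t : ℝ) {ν K : ℕ} (hK : 2 * ν ≤ K) :
    c - (∑ n ∈ Finset.Icc 1 K, s n * (t ^ n / n)) + 2 * ∑ n ∈ Finset.range K, s (n + 1) * t ^ (n + 1)
        - ∑ k ∈ Finset.Icc 1 ν, ∑ n ∈ Finset.range (K - 2 * k + 1),
            s (n + 2 * k) * (b k * ((((n + (2 * k - 1)).choose (2 * k - 1) : ℕ) : ℝ) * t ^ (n + 2 * k)))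
      = c + ∑ N ∈ Finset.Icc 1 K,
          s N * (2 - 1 / N - ∑ k ∈ Finset.Icc 1 ν, b k * (((N - 1).choose (2 * k - 1) : ℕ) : ℝ)) * t ^ N := by
  have hIcc : Finset.Icc 1 K = Finset.Ico 1 (K + 1) := rfl
  -- (i) the shifted range sum
  have h1 : ∑ n ∈ Finset.range K, s (n + 1) * t ^ (n + 1) = ∑ N ∈ Finset.Icc 1 K, s N * t ^ N := by
    rw [hIcc, Finset.sum_Ico_eq_sum_range, Nat.add_sub_cancel]
    exact Finset.sum_congr rfl fun n _ ↦ by rw [add_comm 1 n]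
  -- (ii) the Bernoulli block, one `k` at a time
  have h2 : ∀ k ∈ Finset.Icc 1 ν, ∑ n ∈ Finset.range (K - 2 * k + 1),
      s (n + 2 * k) * (b k * ((((n + (2 * k - 1)).choose (2 * k - 1) : ℕ) : ℝ) * t ^ (n + 2 * k)))
      = ∑ N ∈ Finset.Icc 1 K, s N * (b k * ((((N - 1).choose (2 * k - 1) : ℕ) : ℝ) * t ^ N)) := by
    intro k hk
    rw [Finset.mem_Icc] at hk
    have h2k : 2 * k ≤ K := by omega
    rw [hIcc, ← Finset.sum_Ico_consecutive _ (show 1 ≤ 2 * k by omega) (show 2 * k ≤ K + 1 by omega)]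
    have hzero : ∑ N ∈ Finset.Ico 1 (2 * k),
        s N * (b k * ((((N - 1).choose (2 * k - 1) : ℕ) : ℝ) * t ^ N)) = 0 := by
      refine Finset.sum_eq_zero fun N hN ↦ ?_
      rw [Finset.mem_Ico] at hN
      rw [Nat.choose_eq_zero_of_lt (by omega), Nat.cast_zero, zero_mul, mul_zero, mul_zero]
    rw [hzero, zero_add, Finset.sum_Ico_eq_sum_range, show K + 1 - 2 * k = K - 2 * k + 1 by omega]
    refine Finset.sum_congr rfl fun n _ ↦ ?_
    rw [show 2 * k + n = n + 2 * k by ring, show n + 2 * k - 1 = n + (2 * k - 1) by omega]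
  rw [Finset.sum_congr rfl h2, Finset.sum_comm, h1]
  -- everything is now a sum over `N ∈ Icc 1 K`
  have h3 : ∀ N ∈ Finset.Icc 1 K,
      ∑ k ∈ Finset.Icc 1 ν, s N * (b k * ((((N - 1).choose (2 * k - 1) : ℕ) : ℝ) * t ^ N))
        = s N * t ^ N * ∑ k ∈ Finset.Icc 1 ν, b k * (((N - 1).choose (2 * k - 1) : ℕ) : ℝ) := by
    intro N _
    rw [Finset.mul_sum]
    exact Finset.sum_congr rfl fun k _ ↦ by ring
  rw [Finset.sum_congr rfl h3]
  have h4 : ∀ N ∈ Finset.Icc 1 K,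
      s N * (2 - 1 / N - ∑ k ∈ Finset.Icc 1 ν, b k * (((N - 1).choose (2 * k - 1) : ℕ) : ℝ)) * t ^ N
        = -(s N * (t ^ N / N)) + 2 * (s N * t ^ N)
          - s N * t ^ N * ∑ k ∈ Finset.Icc 1 ν, b k * (((N - 1).choose (2 * k - 1) : ℕ) : ℝ) := by
    intro N _; ring
  rw [Finset.sum_congr rfl h4, Finset.sum_sub_distrib, Finset.sum_add_distrib, Finset.sum_neg_distrib,
    ← Finset.mul_sum]
  ring

/-! ## The two families with collected coefficients -/

/-- **`J_s(m)` as a real polynomial in `1/ω` plus remainder** (`a > 0`, `m : ℤ`, `ω = πm/a ≥ 2`; `ν ≥ 1`, `2ν ≤ K`,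
any `R`).  The remainder is that of `abs_setIntegral_sin_sub_expansion_le` verbatim. -/
theorem abs_setIntegral_sin_sub_realExpansion_le (ha : 0 < a) {m : ℤ} (hm : 2 ≤ π * m / a) {ν : ℕ} (hν : ν ≠ 0)
    {K : ℕ} (hK : 2 * ν ≤ K) (R : ℕ) :
    |(∫ t in Ioc 0 (2 * a), weilArchDensity t * Real.sin (π * m / a * t))
        - (π / 4
            + ∑ N ∈ Finset.Icc 1 K, (if N % 4 = 1 then (1 : ℝ) else if N % 4 = 3 then -1 else 0)
                * (1 - 1 / (2 * (N : ℝ))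
                    - (∑ k ∈ Finset.Icc 1 ν, (bernoulli (2 * k) : ℝ) / (2 * k) * 16 ^ k
                        * (((N - 1).choose (2 * k - 1) : ℕ) : ℝ)) / 2)
                / (2 ^ N * (π * m / a) ^ N)
            - ∑ r ∈ Finset.range R, (-1 : ℝ) ^ r *
                (∑' k : ℕ, Real.exp (-(2 * a * digammaNode k)) * digammaNode k ^ (2 * r)) / (π * m / a) ^ (2 * r + 1))|
      ≤ (4 * Real.pi ^ 2 / 3 * ((2 * ν + 1).factorial : ℝ) / (2 * Real.pi) ^ (2 * ν + 1)
            * (4 * (1 / (4 * (π * m / a / 2)))) ^ (2 * ν)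
          + (1 / (4 * (π * m / a / 2))) ^ (K + 1) / ((K + 1) * (1 - 1 / (4 * (π * m / a / 2))))
          + 2 * (1 / (4 * (π * m / a / 2))) ^ (K + 1)
          + ∑ k ∈ Finset.Icc 1 ν, |(bernoulli (2 * k) : ℝ) / (2 * k)| * 2 ^ (K + 1 + 4 * k)
              * (1 / (4 * (π * m / a / 2))) ^ (K + 1)) / 2
        + (∑' k : ℕ, Real.exp (-(2 * a * digammaNode k)) * digammaNode k ^ (2 * R)) / |π * m / a| ^ (2 * R + 1) := by
  have h := abs_setIntegral_sin_sub_expansion_le ha hm hν hK R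
  have hω : π * m / a ≠ 0 := by intro h0; rw [h0] at hm; linarith
  have key := collect_quarterExpansion (fun n ↦ (I ^ n).im) (fun k ↦ (bernoulli (2 * k) : ℝ) / (2 * k) * 16 ^ k)
    (π / 2) (1 / (4 * (π * m / a / 2))) hK
  beta_reduce at key
  rw [im_quarterExpansion_eq, key] at h
  have htN : ∀ N : ℕ, (1 / (4 * (π * m / a / 2))) ^ N = 1 / (2 ^ N * (π * m / a) ^ N) := by
    intro N
    rw [show (1 / (4 * (π * m / a / 2)) : ℝ) = 1 / (2 * (π * m / a)) by field_simp; ring, one_div_pow, mul_pow]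
  have e : (π / 2 + ∑ N ∈ Finset.Icc 1 K, (I ^ N).im
        * (2 - 1 / N - ∑ k ∈ Finset.Icc 1 ν, (bernoulli (2 * k) : ℝ) / (2 * k) * 16 ^ k
            * (((N - 1).choose (2 * k - 1) : ℕ) : ℝ)) * (1 / (4 * (π * m / a / 2))) ^ N) / 2
      = π / 4 + ∑ N ∈ Finset.Icc 1 K, (if N % 4 = 1 then (1 : ℝ) else if N % 4 = 3 then -1 else 0)
          * (1 - 1 / (2 * (N : ℝ))
              - (∑ k ∈ Finset.Icc 1 ν, (bernoulli (2 * k) : ℝ) / (2 * k) * 16 ^ k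
                  * (((N - 1).choose (2 * k - 1) : ℕ) : ℝ)) / 2)
          / (2 ^ N * (π * m / a) ^ N) := by
    rw [add_div, Finset.sum_div]
    congr 1
    · ring
    refine Finset.sum_congr rfl fun N _ ↦ ?_
    have hI : (I ^ N).im = if N % 4 = 1 then (1 : ℝ) else if N % 4 = 3 then -1 else 0 := by
      rw [I_pow_eq_I_pow_mod_four N]
      have hlt : N % 4 < 4 := Nat.mod_lt _ (by norm_num)
      interval_cases (N % 4) <;> simp [pow_succ, Complex.I_mul_I]
    rw [hI, htN N]
    have h2N : (2 : ℝ) ^ N * (π * m / a) ^ N ≠ 0 := by positivity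
    field_simp
  rw [e] at h
  exact h

/-- **`J_c(m)` as a real polynomial in `1/ω` plus remainder** (`a > 0`, `m : ℤ`, `ω = πm/a ≥ 2`; `ν ≥ 1`, `2ν ≤ K`,
any `R`).  The remainder is that of `abs_setIntegral_one_sub_cos_sub_expansion_le` verbatim. -/
theorem abs_setIntegral_one_sub_cos_sub_realExpansion_le (ha : 0 < a) {m : ℤ} (hm : 2 ≤ π * m / a) {ν : ℕ}
    (hν : ν ≠ 0) {K : ℕ} (hK : 2 * ν ≤ K) (R : ℕ) :
    |(∫ t in Ioc 0 (2 * a), weilArchDensity t * (1 - Real.cos (π * m / a * t)))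
        - (Real.log (π * m / a / 2) / 2
            + ∑ N ∈ Finset.Icc 1 K, (if N % 4 = 0 then (1 : ℝ) else if N % 4 = 2 then -1 else 0)
                * (1 - 1 / (2 * (N : ℝ))
                    - (∑ k ∈ Finset.Icc 1 ν, (bernoulli (2 * k) : ℝ) / (2 * k) * 16 ^ k
                        * (((N - 1).choose (2 * k - 1) : ℕ) : ℝ)) / 2)
                / (2 ^ N * (π * m / a) ^ N)
            - reDigammaQuarter 0 / 2
            - (∑' k : ℕ, Real.exp (-(2 * a * digammaNode k)) / digammaNode k)
            + ∑ r ∈ Finset.range R, (-1 : ℝ) ^ r *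
                (∑' k : ℕ, Real.exp (-(2 * a * digammaNode k)) * digammaNode k ^ (2 * r + 1)) / (π * m / a) ^ (2 * r + 2))|
      ≤ (4 * Real.pi ^ 2 / 3 * ((2 * ν + 1).factorial : ℝ) / (2 * Real.pi) ^ (2 * ν + 1)
            * (4 * (1 / (4 * (π * m / a / 2)))) ^ (2 * ν)
          + (1 / (4 * (π * m / a / 2))) ^ (K + 1) / ((K + 1) * (1 - 1 / (4 * (π * m / a / 2))))
          + 2 * (1 / (4 * (π * m / a / 2))) ^ (K + 1)
          + ∑ k ∈ Finset.Icc 1 ν, |(bernoulli (2 * k) : ℝ) / (2 * k)| * 2 ^ (K + 1 + 4 * k)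
              * (1 / (4 * (π * m / a / 2))) ^ (K + 1)) / 2
        + (∑' k : ℕ, Real.exp (-(2 * a * digammaNode k)) * digammaNode k ^ (2 * R + 1))
            / |π * m / a| ^ (2 * R + 2) := by
  have h := abs_setIntegral_one_sub_cos_sub_expansion_le ha hm hν hK R
  have hω : π * m / a ≠ 0 := by intro h0; rw [h0] at hm; linarith
  have key := collect_quarterExpansion (fun n ↦ (I ^ n).re) (fun k ↦ (bernoulli (2 * k) : ℝ) / (2 * k) * 16 ^ k)
    (Real.log (π * m / a / 2)) (1 / (4 * (π * m / a / 2))) hK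
  beta_reduce at key
  rw [re_quarterExpansion_eq, key] at h
  have htN : ∀ N : ℕ, (1 / (4 * (π * m / a / 2))) ^ N = 1 / (2 ^ N * (π * m / a) ^ N) := by
    intro N
    rw [show (1 / (4 * (π * m / a / 2)) : ℝ) = 1 / (2 * (π * m / a)) by field_simp; ring, one_div_pow, mul_pow]
  have e : (Real.log (π * m / a / 2) + ∑ N ∈ Finset.Icc 1 K, (I ^ N).re
        * (2 - 1 / N - ∑ k ∈ Finset.Icc 1 ν, (bernoulli (2 * k) : ℝ) / (2 * k) * 16 ^ k
            * (((N - 1).choose (2 * k - 1) : ℕ) : ℝ)) * (1 / (4 * (π * m / a / 2))) ^ N) / 2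
      = Real.log (π * m / a / 2) / 2
        + ∑ N ∈ Finset.Icc 1 K, (if N % 4 = 0 then (1 : ℝ) else if N % 4 = 2 then -1 else 0)
          * (1 - 1 / (2 * (N : ℝ))
              - (∑ k ∈ Finset.Icc 1 ν, (bernoulli (2 * k) : ℝ) / (2 * k) * 16 ^ k
                  * (((N - 1).choose (2 * k - 1) : ℕ) : ℝ)) / 2)
          / (2 ^ N * (π * m / a) ^ N) := by
    rw [add_div, Finset.sum_div]
    congr 1
    refine Finset.sum_congr rfl fun N _ ↦ ?_
    have hI : (I ^ N).re = if N % 4 = 0 then (1 : ℝ) else if N % 4 = 2 then -1 else 0 := by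
      rw [I_pow_eq_I_pow_mod_four N]
      have hlt : N % 4 < 4 := Nat.mod_lt _ (by norm_num)
      interval_cases (N % 4) <;> simp [pow_succ, Complex.I_mul_I]
    rw [hI, htN N]
    have h2N : (2 : ℝ) ^ N * (π * m / a) ^ N ≠ 0 := by positivity
    field_simp
  rw [e] at h
  exact h

end Summit.RiemannHypothesis.RiemannHypothesis.Theorems.WeilFormatC
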